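import Literature.NumberTheory.EllipticCurves.CastellaGrossiLeeSkinner2022.BDPValueAtTrivialCharacter
import HarnessLib

/-!
# Burungale–Castella–Skinner 2025, Thm. 1.2.4 (b) (the anticyclotomic BDP main conjecture for
# `X_Gr(E/K_∞⁻)` in `Λ⁻,ur`, PROVED under (sur)) AT THE TRIVIAL CHARACTER, combined with
# Castella–Grossi–Lee–Skinner 2022 Thm. 5.1.3 (the Bertolini–Darmon–Prasanna formula for
# `L_p^BDP(E/K)(𝟙)`): `𝓕(0) = u · c_E⁻² (1 − a_p p⁻¹ + p⁻¹)² log_{ω_E}(P_K)²`, ON THE LITERATURE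
# OBJECT `X_ac` — the IRREDUCIBLE-image twin of `CastellaGrossiLeeSkinner2022/BDPValueAtTrivialCharacter.lean`

HONEST FRAMING (cell `b2b-bsdres`, run/shared/lean/b2b/bsd-rank1-residual/; page 1 everywhere):
the goal of the cell is to DELETE the COMBINATION-SHAPED residual classes of the BSD formula for ALL
analytic-rank `≤ 1` curves over `ℚ` from PUBLISHED theorems only, so that the remainder becomes
exactly the CONSTRUCTION-SHAPED classes, which are TYPED, not attempted; this is not "finishing
BSD". This file vendors ONE published statement as a named fact (`def … : Prop`, nothing asserted;
D-0014/D-0026) and PROVES its bookkeeping consumers. Unit `b2b-bsdres-lit-glue` (GLUE seat, gen 6);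
sized ask S15 of `HOME/b2b-bsdres-lit-cgls/CGLS-GV-TYPING.md` §13.5 ("the SAME composite pattern …
types Burungale–Castella–Skinner 2025 Thm 1.2.4(b) [integral under (sur)] ∘ the BDP formula … which
would feed `IMCWaldspurgerOnTreeGoodAt` at IRREDUCIBLE good ordinary `p > 3` (rows C2/C3-ord)").

## What and why

The covered IRREDUCIBLE rank-one rows of the cell (C2 `r = 1` = BCS 2025 Cor. 1.3.1, C3-ordinary =
JSW 2017 Thm. 1.2.1 at `p ≥ 5`) stand, at main-conjecture level, on two links per anticyclotomic
datum on the `Λ`-module `X_ac`: the control link (now PUBLISHED: CGLS 2022 Thm. 5.1.1 = A170 off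
the anomalous line, JSW 2017 Thm. 3.3.1 = `JetchevSkinnerWan2017.thm331_anticyclotomicControl`
everywhere) and the main-conjecture link (IMC∘BDP)ᵍ `X11b.IMCWaldspurgerOnTreeGoodAt` — still a
typed Summits-side SHAPE, whose printed source at a good ordinary irreducible `p > 3` is
Burungale–Castella–Skinner 2025 Thm. 1.2.4 composed with the BDP formula at the trivial character,
exactly as BCS's own proof of Cor. 1.3.1 composes them ("the result in the case `r = 1` follows from
Theorem 1.2.4, the `p`-adic Waldspurger formula [BDP13] for the value of `L_p^BDP(E/K)` at the
trivial character, the anticyclotomic control theorem [JSW17, Thm. 3.3.1], and the `r = 0` result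
for the `K`-quadratic twist of `E`", p. 4). This file vendors that composite, in the form already
established in the cell for the Eisenstein column by `display54_thm513_generator_constantCoeff`
(A173, lit-cgls session 6): Thm. 1.2.4 (b) enters ONLY through "a generator `𝓕` of
`ch_Λ(X_Gr(E/K_∞⁻))` satisfies `𝓕(0) = u · L_p^BDP(E/K)(𝟙)`, `u ∈ (ℤ_p^ur)^×`" (two generators of a
principal ideal of the domain `Λ^ur` differ by a unit, whose constant term is a unit of `ℤ_p^ur`),
and `L_p^BDP(E/K)(𝟙)` is evaluated by CGLS 2022 Thm. 5.1.3 (the BDP formula at the trivial character,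
a numbered theorem for any `E/ℚ` at a good `p > 2` split in `K` with the Heegner hypothesis; BCS's
`L_p^BDP(E/K) ∈ Λ⁻,ur` "constructed in op. cit." = [BDP13], [CH18] is CGLS's `𝓛_E` of their
Thm. 2.1.1, same authors, same construction [CH18, Prop. 3.8]). No object for `Λ^ur` / `L_p^BDP` is
needed: the identity lives in `K_v = ℚ_p` with `u ∈ ℚ_p ∩ (ℤ_p^ur)^× = ℤ_p^×` (A173's remark).

## Citation header

* **[BurungaleCastellaSkinner2025]** Ashay Burungale, Francesc Castella, Christopher Skinner, *Base
  change and Iwasawa main conjectures for GL₂*, Int. Math. Res. Not. IMRN **2025**, no. 8, rnaf082,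
  doi:10.1093/imrn/rnaf082 = arXiv:2405.00270v2 (18 Mar 2025); read by this seat on the store's text
  `paper:arxiv-2405.00270` (p0002–p0006, p0008, p0011). REFEREED / PUBLISHED (Crossref; the cell's
  registry row T-BCS / A148 carries the referee's flag for this paper, inherited here).
  Setting (§1.2, p. 2 bottom – p. 3, verbatim): "Assume that the discriminant `D_K < 0` satisfies
  `D_K` is odd and `D_K ≠ −3`. (disc) Moreover, assume that `K` satisfies the Heegner hypothesis,
  namely every prime `ℓ | N` splits in `K`, (Heeg) and that `p = v v̄` splits in `K` (spl) for `v`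
  the prime of `K` above `p` induced by an embedding `ℚ̄ ↪ ℚ̄_p`, which we fix throughout. Let
  `K_∞⁻/K` be the anticyclotomic `ℤ_p`-extension, `Γ_K⁻ = Gal(K_∞⁻/K)`, and `Λ_K⁻ = ℤ_p⟦Γ_K⁻⟧`";
  Thm. 1.2.2's data: "Let `E` be an elliptic curve defined over `ℚ` of conductor `N`, `p` be a prime
  of good ordinary reduction for `E`, and `K` an imaginary quadratic field satisfying (disc), (Heeg),
  and (spl)"; p. 3: "In light of the `Λ_K⁻`-adic analogue of the `p`-adic Waldspurger formula of
  [BDP13] (see [CH18]), Conjecture 1.2.1 is equivalent to the prediction that the `p`-adic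
  `L`-function `L_p^BDP(E/K) ∈ Λ_K^{−,ur}` constructed in op. cit. generates the characteristic ideal
  of the anticyclotomic Selmer group `X_Gr(E/K_∞⁻)` whose classes are locally trivial (resp.
  unrestricted) at the primes above `v̄` (resp. `v`). Here we put `Λ_K^{−,ur} = Λ_K⁻ ⊗̂_{ℤ_p} ℤ_p^ur`".
  **Theorem 1.2.4** (p. 3, verbatim): "Let `(E, p, K)` be as in Theorem 1.2.2. (a) If `p > 3`
  satisfies (irr_ℚ), then `X_Gr(E/K_∞⁻)` is `Λ_K⁻`-torsion, and `ch_{Λ_K⁻}(X_Gr(E/K_∞⁻)) =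
  (L_p^BDP(E/K))` in `Λ_K^{−,ur} ⊗ ℚ_p`. (b) If further `p > 3` satisfies (sur), then the equality
  of characteristic ideals holds in `Λ_K^{−,ur}`." ((sur) = "`ρ̄_E : G_ℚ → Aut_{𝔽_p}(E[p])` is
  surjective", p. 3.) Proof: p. 11 ("Proof of Theorem 1.2.2 and Theorem 1.2.4": (5.5) + [CGS23,
  Prop. 1.4.5] + [JSW17, Cor. 3.4.2] + Thm. 4.2.1 = [CGS23, Thm. 5.5.2] / [How04, Thm. B] +
  [BCK21, Thm. 5.2]; the `μ`-invariant input [Hsi14], [Bur17]).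
* **[CastellaGrossiLeeSkinner2022]** Invent. Math. **227** (2022), **Thm. 5.1.3** (verbatim, with
  the data of §5.1.2 — `E/ℚ` of conductor `N`, `π : X₀(N) → E`, `K` with the Heegner hypothesis
  relative to `N`, `𝔑`, `P_K = Σ_σ π(x₁)^σ ∈ E(K)`, `c_E` the Manin constant, `π^*(ω_E) = c_E ω_f`):
  "let `p > 2` be a prime of good reduction for `E` such that `p = v v̄` splits in `K`. Then
  `𝓛_E(0) = c_E⁻² · (1 − a_p p⁻¹ + p⁻¹)² · log_{ω_E}(P_K)²`, where `log_{ω_E} : E(K_v) → K_v` is the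
  formal group logarithm associated to `ω_E`" (arXiv:2008.02571v2 TeX L2463–L2471; read in the cell
  by lit-cgls, `BDPValueAtTrivialCharacter.lean`). No reducibility hypothesis (BDP13 Thm. 5.13 at
  `k = 2`).

## Transcription (tree vocabulary; every symbol a Literature object; binders = A173's with BCS's
## hypotheses in place of CGLS Thm. 4.2.2's)

* "`E/ℚ` of conductor `N`, `p > 3` good ordinary, (sur)" = a globally minimal `W`, `3 < p`,
  `GoodOrd W p`, `Surj W p` (the cell's `Rank1Residual` predicates).
* `K`: `IsImaginaryQuadratic K`; (Heeg) `SatisfiesHeegnerHypothesis (W.conductorNorm ℤ) K`; (spl)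
  `SatisfiesHeegnerHypothesis p K`; (disc) `Odd (discr K) ∧ discr K ≠ -3`. NO (Sel), NO reducibility.
* "`v` induced by the fixed embedding, `v̄`", "`Γ⁻`, `γ`, `Λ⁻`", "`X_Gr(E/K_∞⁻)`": EXACTLY A170/A173's
  binders: `ι : K →+* ℚ_[p]`, `v` with `x ∈ v ⟺ ‖ι x‖ < 1`, `vbar ∋ p`, `vbar ≠ v`; `κ` anticyclotomic
  with topological generator `γ`; `X_Gr(E/K_∞⁻) = AcSelmer.XAc (W.baseChange K) p κ vbar ∅ γ`
  ("locally trivial at the primes above `v̄`, unrestricted at `v`"; `K_∞`-formulation; reading flag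
  offered `BCS-124-XGr-reading`: the formal §2.1 Greenberg condition at `w ∣ v̄` for the
  `(d+1)`-variable module is "unramified", the Intro's description of `X_Gr(E/K_∞⁻)` "locally
  trivial" — the latter transcribed, as for CGLS's `𝔛_E` and CGS 2025's `𝔛_Gr(E/K_∞⁻)` in A170/A173).
* "`π`, `c_E`, `𝔑`, `P_K`, `log_{ω_E}(P_K)`": EXACTLY A173's `(Dt, H, ιC, P)` and the element-level
  log reading `log_W(z(m₀ • P_ι))/m₀` of `PadicFormalLogOrder.lean` (CGLS letter: log on `E(K_v)`,
  `v` induced by `ι`).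
* Conclusion: identical in shape to A173's — `X_Gr` is `Λ`-torsion and there is a generator `F` of
  `ch_Λ(X_Gr)` and `u ∈ ℤ_p^×` with `F(0) = u · c_E⁻² · (1 − a_p p⁻¹ + p⁻¹)² · log_{ω_E}(P_K)²` in
  `ℚ_p`. COMPOSITE OF TWO PRINTED, PUBLISHED THEOREMS, assembled as BCS's proof of Cor. 1.3.1 (r = 1)
  assembles them; nothing asserted.

## Contents

* `thm124b_thm513_generator_constantCoeff` — the named fact (ONE new `def … : Prop`).
* PROVED: `generator_constantCoeff_eq_of_thm124b`, `valuation_generator_constantCoeff_of_thm124b`,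
  `hasCharValuationAt_of_thm124b` (the packaged shape `∃ n, AcSelmer.XAc.HasCharValuationAt … n ∧
  n = 2·(ord_p(1 − a_p + p) − 1 + ord_p log_{ω_E} P_K) − 2·ord_p c_E` — LITERALLY the body of the
  Summits predicate `X11b.IMCWaldspurgerOnTreeGoodAt p κ vbar γ ι P` up to the Manin term).

## References
* [BurungaleCastellaSkinner2025] IMRN 2025 rnaf082 = arXiv:2405.00270v2: §1.2 (setting), Thm. 1.2.4,
  proof of Cor. 1.3.1 (p. 4), §5 (proof, p. 11).
* [CastellaGrossiLeeSkinner2022] Invent. Math. 227 (2022): Thm. 5.1.3 with §5.1.2; Thm. 2.1.1.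
* [BertoliniDarmonPrasanna2013] Duke Math. J. 162: Thm. 5.13. [CastellaHsieh2018] (`L_p^BDP`).
* Tree: `CastellaGrossiLeeSkinner2022/BDPValueAtTrivialCharacter.lean` (A173, the Eisenstein twin),
  `JetchevSkinnerWan2017/AnticyclotomicControl.lean`, `CastellaGrossiLeeSkinner2022/AnticyclotomicControl.lean`
  (A170); HOME/b2b-bsdres-lit-cgls/CGLS-GV-TYPING.md §13.5 (S15); HOME/b2b-bsdres-lit-glue/GLUE.md GEN 6.
-/

set_option autoImplicit false

noncomputable section

open scoped Classical

open WeierstrassCurve NumberField IsDedekindDomain Field Literature.NumberTheory.EllipticCurves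
  Literature.NumberTheory.EllipticCurves.ModularForms Literature.NumberTheory.QuadraticFields
  Literature.NumberTheory.EllipticCurves.Rank1Residual
  Literature.NumberTheory.EllipticCurves.Castella2018

namespace Literature.NumberTheory.EllipticCurves.BurungaleCastellaSkinner2025

/-- **Burungale–Castella–Skinner, IMRN 2025 (rnaf082) = arXiv:2405.00270v2, Theorem 1.2.4 (b) at
the trivial character, combined with Castella–Grossi–Lee–Skinner, Invent. Math. 227 (2022)
Theorem 5.1.3 (the Bertolini–Darmon–Prasanna formula), as BCS's proof of Cor. 1.3.1 (`r = 1`)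
combines them.** Thm. 1.2.4 (verbatim; data of Thm. 1.2.2: "`E` an elliptic curve defined over `ℚ`
of conductor `N`, `p` a prime of good ordinary reduction for `E`, and `K` an imaginary quadratic
field satisfying (disc) [`D_K` odd, `D_K ≠ −3`], (Heeg) [every `ℓ ∣ N` splits in `K`], and (spl)
[`p = v v̄` splits, `v` induced by the fixed embedding `ℚ̄ ↪ ℚ̄_p`]"): "(a) If `p > 3` satisfies
(irr_ℚ), then `X_Gr(E/K_∞⁻)` is `Λ_K⁻`-torsion, and `ch_{Λ_K⁻}(X_Gr(E/K_∞⁻)) = (L_p^BDP(E/K))` in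
`Λ_K^{−,ur} ⊗ ℚ_p`. (b) If further `p > 3` satisfies (sur), then the equality of characteristic
ideals holds in `Λ_K^{−,ur}`." — `X_Gr(E/K_∞⁻)` "the anticyclotomic Selmer group whose classes are
locally trivial (resp. unrestricted) at the primes above `v̄` (resp. `v`)", `Λ_K^{−,ur} = Λ_K⁻ ⊗̂
ℤ_p^ur`, `L_p^BDP(E/K) ∈ Λ_K^{−,ur}` the BDP `p`-adic `L`-function of [BDP13]/[CH18] (p. 3). At the
trivial character, (b) gives: a generator `𝓕 ∈ Λ` of `ch(X_Gr(E/K_∞⁻))` satisfies `𝓕(0) = u ·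
L_p^BDP(E/K)(𝟙)` for some `u ∈ (ℤ_p^ur)^×` (two generators of a principal ideal of the domain
`Λ^{−,ur}` differ by a unit, whose constant term is a unit of `ℤ_p^ur`). CGLS Thm. 5.1.3 (verbatim,
data of §5.1.2: `E/ℚ` of conductor `N`, `π : X₀(N) → E`, `K` with the Heegner hypothesis relative to
`N`, `𝔑`, `P_K = Σ_{σ ∈ Gal(H/K)} π(x₁)^σ ∈ E(K)`, `c_E` the Manin constant, `π^*(ω_E) = c_E ω_f`):
"let `p > 2` be a prime of good reduction for `E` such that `p = v v̄` splits in `K`. Then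
`𝓛_E(0) = c_E⁻² · (1 − a_p p⁻¹ + p⁻¹)² · log_{ω_E}(P_K)²`, where `log_{ω_E} : E(K_v) → K_v` is the
formal group logarithm associated to `ω_E`" (`𝓛_E` = `L_p^BDP(E/K)`, the same construction [CH18,
Prop. 3.8]). COMBINED ("the result in the case `r = 1` follows from Theorem 1.2.4, the `p`-adic
Waldspurger formula [BDP13] for the value of `L_p^BDP(E/K)` at the trivial character, …", BCS p. 4):
`𝓕(0) = u · c_E⁻² (1 − a_p p⁻¹ + p⁻¹)² log_{ω_E}(P_K)²`, an identity in `K_v = ℚ_p`, so that `u ∈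
ℚ_p ∩ (ℤ_p^ur)^× = ℤ_p^×` whenever the value is non-zero (and `u := 1` serves when it is zero).
TRANSCRIBED (module docstring for the dictionary): `W` globally minimal, `3 < p`, `GoodOrd W p`,
`Surj W p`; `K` imaginary quadratic with (Heeg) for `N_E`, (spl), (disc) `D_K` odd `≠ −3`;
`(ι, v, vbar, κ, γ)` and `X_Gr(E/K_∞⁻) = AcSelmer.XAc (W.baseChange K) p κ vbar ∅ γ` exactly as in
`CastellaGrossiLeeSkinner2022.thm511_anticyclotomicControl` (strict at `v̄`, relaxed at `v`;
`K_∞`-formulation; reading flag `BCS-124-XGr-reading` in the module docstring); `(Dt, H, ιC, P)`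
exactly as in `display55_sha_heegnerIndex` (`Dt.c = c_E`, `ιC(P) = P_K`); `log_{ω_E}(P_K) = log_W(z(m₀
• P_ι))/m₀` (`padicLogPoint`, `formalIndex`, `padicPointOf`); conclusion: `X_Gr` is `Λ`-torsion and
there is a generator `F` of `ch_Λ(X_Gr)` and `u ∈ ℤ_p^×` with `F(0) = u · c_E⁻² · (1 − a_p p⁻¹ +
p⁻¹)² · log_{ω_E}(P_K)²` in `ℚ_p`. COMPOSITE OF TWO PRINTED, PUBLISHED THEOREMS; nothing asserted.
[cite: BurungaleCastellaSkinner2025, Thm. 1.2.4 (b) (§1.2, p. 3; arXiv:2405.00270v2 p0003) with the setting of §1.2 (pp. 2–3) and the proof of Cor. 1.3.1 (p. 4)]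
[cite: CastellaGrossiLeeSkinner2022, Thm. 5.1.3 (TeX `thmpadicGZ`, L2463–L2471) with §5.1.2 (L2434–L2447)]
[cite: BertoliniDarmonPrasanna2013, Thm. 5.13 (the source of Thm. 5.1.3)] -/
def thm124b_thm513_generator_constantCoeff : Prop :=
  ∀ (W : WeierstrassCurve ℚ) [W.IsElliptic] [W.IsGloballyMinimal] (p : ℕ) [Fact p.Prime],
    3 < p → GoodOrd W p → Surj W p →
    ∀ (K : Type) [Field K] [NumberField K], IsImaginaryQuadratic K →
      SatisfiesHeegnerHypothesis (W.conductorNorm ℤ) K → SatisfiesHeegnerHypothesis p K →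
      Odd (NumberField.discr K) → NumberField.discr K ≠ -3 →
    ∀ (ι : K →+* ℚ_[p]) (v vbar : HeightOneSpectrum (𝓞 K)),
      (∀ x : 𝓞 K, x ∈ v.asIdeal ↔ ‖ι (x : K)‖ < 1) →
      ((p : ℕ) : 𝓞 K) ∈ vbar.asIdeal → vbar ≠ v →
    ∀ (κ : ZpExtension K p), κ.IsAnticyclotomic →
    ∀ (γ : absoluteGaloisGroup K) [Fact (κ.IsTopGenerator γ)],
    ∀ (N : ℕ) [NeZero N] (Dt : ModularParametrizationData W N)
      (H : HeegnerDatum N (NumberField.discr K)) (ιC : K →+* ℂ) (P : (W.baseChange K).toAffine.Point),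
      WeierstrassCurve.Affine.Point.map ιC.toRatAlgHom P = heegnerPointComplex Dt H →
      Module.IsTorsion (IwasawaAlgebra p) (AcSelmer.XAc (W.baseChange K) p κ vbar ∅ γ) ∧
      ∃ F : IwasawaAlgebra p,
        AcSelmer.XAc.charIdeal (W.baseChange K) p κ vbar ∅ γ = Ideal.span {F} ∧
        ∃ u : ℤ_[p]ˣ,
          ((PowerSeries.constantCoeff F : ℤ_[p]) : ℚ_[p]) =
            ((u : ℤ_[p]) : ℚ_[p]) * ((Dt.c : ℚ_[p])⁻¹) ^ 2 *
              (1 - (W.frobeniusTrace p : ℚ_[p]) * (p : ℚ_[p])⁻¹ + (p : ℚ_[p])⁻¹) ^ 2 *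
              ((W.baseChange ℚ_[p]).padicLogPoint (formalIndex W p • padicPointOf W p ι P) /
                (formalIndex W p : ℚ_[p])) ^ 2

/-! ### A `p`-adic valuation computation (standard API; no mathematical content of its own) -/

section Valuation

variable {p : ℕ} [hp : Fact p.Prime]

/-- `ord_p` of the right-hand side of (5.4) ∘ Thm. 5.1.3: for a unit `u ∈ ℤ_p^×`, integers `c, a`,
`L ∈ ℚ_p` and `m ∈ ℕ`, if `u · c⁻² · (1 − a p⁻¹ + p⁻¹)² · (L/m)² ≠ 0` then its valuation is
`2·(ord_p(1 − a + p) − 1 + (ord_p L − ord_p m)) − 2·ord_p c` (each factor is non-zero, `ord_p` is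
additive, `1 − a p⁻¹ + p⁻¹ = (1 − a + p)/p`). Private helper. [folklore] -/
private theorem valuation_unit_mul_bdpShape' (u : ℤ_[p]ˣ) (c a : ℤ) (L : ℚ_[p]) (m : ℕ)
    (h : ((u : ℤ_[p]) : ℚ_[p]) * ((c : ℚ_[p])⁻¹) ^ 2 *
        (1 - (a : ℚ_[p]) * (p : ℚ_[p])⁻¹ + (p : ℚ_[p])⁻¹) ^ 2 * (L / (m : ℚ_[p])) ^ 2 ≠ 0) :
    (((u : ℤ_[p]) : ℚ_[p]) * ((c : ℚ_[p])⁻¹) ^ 2 *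
        (1 - (a : ℚ_[p]) * (p : ℚ_[p])⁻¹ + (p : ℚ_[p])⁻¹) ^ 2 * (L / (m : ℚ_[p])) ^ 2).valuation =
      2 * ((padicValInt p (1 - a + p) : ℤ) - 1 + (L.valuation - (padicValNat p m : ℤ))) -
        2 * (padicValInt p c : ℤ) := by
  have hp0 : (p : ℚ_[p]) ≠ 0 := by exact_mod_cast hp.out.ne_zero
  have hu0 : ((u : ℤ_[p]) : ℚ_[p]) ≠ 0 := PadicInt.coe_ne_zero.2 u.ne_zero
  have hc0 : ((c : ℚ_[p])⁻¹) ≠ 0 := by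
    intro h0; apply h; rw [h0]; ring
  have hA0 : (1 - (a : ℚ_[p]) * (p : ℚ_[p])⁻¹ + (p : ℚ_[p])⁻¹) ≠ 0 := by
    intro h0; apply h; rw [h0]; ring
  have hLm0 : L / (m : ℚ_[p]) ≠ 0 := by
    intro h0; apply h; rw [h0]; ring
  have hL0 : L ≠ 0 := by
    intro h0; apply hLm0; rw [h0, zero_div]
  have hm0 : (m : ℚ_[p]) ≠ 0 := by
    intro h0; apply hLm0; rw [h0, div_zero]
  -- `1 − a p⁻¹ + p⁻¹ = (1 − a + p)/p`
  have hAeq : (1 - (a : ℚ_[p]) * (p : ℚ_[p])⁻¹ + (p : ℚ_[p])⁻¹) =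
      ((1 - a + p : ℤ) : ℚ_[p]) * (p : ℚ_[p])⁻¹ := by
    push_cast
    field_simp
    ring
  have hA1 : ((1 - a + p : ℤ) : ℚ_[p]) ≠ 0 := by
    intro h0; apply hA0; rw [hAeq, h0, zero_mul]
  -- valuations of the four factors
  have hvu : ((u : ℤ_[p]) : ℚ_[p]).valuation = 0 := by
    simp only [PadicInt.valuation_coe, padicInt_valuation_eq_zero_of_isUnit u.isUnit, Nat.cast_zero]
  have hvc : ((c : ℚ_[p])⁻¹).valuation = -(padicValInt p c : ℤ) := by
    rw [Padic.valuation_inv, Padic.valuation_intCast]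
  have hvA : (1 - (a : ℚ_[p]) * (p : ℚ_[p])⁻¹ + (p : ℚ_[p])⁻¹).valuation =
      (padicValInt p (1 - a + p) : ℤ) - 1 := by
    rw [hAeq, Padic.valuation_mul hA1 (inv_ne_zero hp0), Padic.valuation_intCast,
      Padic.valuation_inv, Padic.valuation_p]
    ring
  have hvL : (L / (m : ℚ_[p])).valuation = L.valuation - (padicValNat p m : ℤ) := by
    rw [div_eq_mul_inv, Padic.valuation_mul hL0 (inv_ne_zero hm0), Padic.valuation_inv,
      Padic.valuation_natCast]
    ring
  rw [Padic.valuation_mul (mul_ne_zero (mul_ne_zero hu0 (pow_ne_zero 2 hc0)) (pow_ne_zero 2 hA0))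
      (pow_ne_zero 2 hLm0),
    Padic.valuation_mul (mul_ne_zero hu0 (pow_ne_zero 2 hc0)) (pow_ne_zero 2 hA0),
    Padic.valuation_mul hu0 (pow_ne_zero 2 hc0), Padic.valuation_pow, Padic.valuation_pow,
    Padic.valuation_pow, hvu, hvc, hvA, hvL]
  ring

end Valuation

variable {W : WeierstrassCurve ℚ} [W.IsElliptic] [W.IsGloballyMinimal] {p : ℕ} [Fact p.Prime]

/-! ### Bookkeeping consumers -/

/-- **Every generator satisfies the identity (with its own unit).** Granted the fact, if
`ch_Λ(X_Gr) = (𝓖)` for ANY `𝓖 ∈ Λ`, then `𝓖(0) = u' · c_E⁻² (1 − a_p p⁻¹ + p⁻¹)² log_{ω_E}(P_K)²` for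
some `u' ∈ ℤ_p^×` (two generators of a principal ideal of the domain `Λ = ℤ_p⟦T⟧` differ by a unit of
`Λ`, whose constant term is a unit of `ℤ_p`).
[cite: BurungaleCastellaSkinner2025, Thm. 1.2.4 (b) (p. 3)] -/
theorem generator_constantCoeff_eq_of_thm124b (h : thm124b_thm513_generator_constantCoeff)
    (hp : 3 < p) (hord : GoodOrd W p) (hsurj : Surj W p)
    (K : Type) [Field K] [NumberField K] (hK : IsImaginaryQuadratic K)
    (hHN : SatisfiesHeegnerHypothesis (W.conductorNorm ℤ) K) (hHp : SatisfiesHeegnerHypothesis p K)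
    (hodd : Odd (NumberField.discr K)) (h3 : NumberField.discr K ≠ -3)
    (ι : K →+* ℚ_[p]) (v vbar : HeightOneSpectrum (𝓞 K))
    (hv : ∀ x : 𝓞 K, x ∈ v.asIdeal ↔ ‖ι (x : K)‖ < 1)
    (hvbar : ((p : ℕ) : 𝓞 K) ∈ vbar.asIdeal) (hne : vbar ≠ v)
    (κ : ZpExtension K p) (hκ : κ.IsAnticyclotomic)
    (γ : absoluteGaloisGroup K) [Fact (κ.IsTopGenerator γ)]
    {N : ℕ} [NeZero N] (Dt : ModularParametrizationData W N)
    (H : HeegnerDatum N (NumberField.discr K)) (ιC : K →+* ℂ) (P : (W.baseChange K).toAffine.Point)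
    (hP : WeierstrassCurve.Affine.Point.map ιC.toRatAlgHom P = heegnerPointComplex Dt H)
    (G : IwasawaAlgebra p) (hG : AcSelmer.XAc.charIdeal (W.baseChange K) p κ vbar ∅ γ = Ideal.span {G}) :
    ∃ u' : ℤ_[p]ˣ,
      ((PowerSeries.constantCoeff G : ℤ_[p]) : ℚ_[p]) =
        ((u' : ℤ_[p]) : ℚ_[p]) * ((Dt.c : ℚ_[p])⁻¹) ^ 2 *
          (1 - (W.frobeniusTrace p : ℚ_[p]) * (p : ℚ_[p])⁻¹ + (p : ℚ_[p])⁻¹) ^ 2 *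
          ((W.baseChange ℚ_[p]).padicLogPoint (formalIndex W p • padicPointOf W p ι P) /
            (formalIndex W p : ℚ_[p])) ^ 2 := by
  obtain ⟨-, F, hF, u, hu⟩ :=
    h W p hp hord hsurj K hK hHN hHp hodd h3 ι v vbar hv hvbar hne κ hκ γ N Dt H ιC P hP
  -- `G = F · w` for a unit `w` of `Λ`; `w(0)` is a unit of `ℤ_p`
  obtain ⟨w, rfl⟩ := Ideal.span_singleton_eq_span_singleton.mp (hF.symm.trans hG)
  have hw : IsUnit (PowerSeries.constantCoeff (w : IwasawaAlgebra p)) :=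
    PowerSeries.isUnit_constantCoeff _ w.isUnit
  refine ⟨u * hw.unit, ?_⟩
  rw [map_mul, PadicInt.coe_mul, hu, Units.val_mul, PadicInt.coe_mul, IsUnit.unit_spec]
  ring

/-- **The identity in valuations** — the currency of the control facts (A170, JSW 3.3.1) and of the
cell's `AcSelmer.XAc.HasCharValuationAt`: granted the fact, for EVERY generator `𝓖` of `ch_Λ(X_Gr)`
with `𝓖(0) ≠ 0`, `ord_p 𝓖(0) = 2·(ord_p(1 − a_p + p) − 1 + ord_p log_{ω_E} P_K) − 2·ord_p c_E`, where
`ord_p log_{ω_E} P_K = padicLogOrd W p ι P`. [cite: BurungaleCastellaSkinner2025, Thm. 1.2.4 (b) (p. 3) with the proof of Cor. 1.3.1 (p. 4)]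
[cite: CastellaGrossiLeeSkinner2022, Thm. 5.1.3] -/
theorem valuation_generator_constantCoeff_of_thm124b (h : thm124b_thm513_generator_constantCoeff)
    (hp : 3 < p) (hord : GoodOrd W p) (hsurj : Surj W p)
    (K : Type) [Field K] [NumberField K] (hK : IsImaginaryQuadratic K)
    (hHN : SatisfiesHeegnerHypothesis (W.conductorNorm ℤ) K) (hHp : SatisfiesHeegnerHypothesis p K)
    (hodd : Odd (NumberField.discr K)) (h3 : NumberField.discr K ≠ -3)
    (ι : K →+* ℚ_[p]) (v vbar : HeightOneSpectrum (𝓞 K))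
    (hv : ∀ x : 𝓞 K, x ∈ v.asIdeal ↔ ‖ι (x : K)‖ < 1)
    (hvbar : ((p : ℕ) : 𝓞 K) ∈ vbar.asIdeal) (hne : vbar ≠ v)
    (κ : ZpExtension K p) (hκ : κ.IsAnticyclotomic)
    (γ : absoluteGaloisGroup K) [Fact (κ.IsTopGenerator γ)]
    {N : ℕ} [NeZero N] (Dt : ModularParametrizationData W N)
    (H : HeegnerDatum N (NumberField.discr K)) (ιC : K →+* ℂ) (P : (W.baseChange K).toAffine.Point)
    (hP : WeierstrassCurve.Affine.Point.map ιC.toRatAlgHom P = heegnerPointComplex Dt H)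
    (G : IwasawaAlgebra p) (hG : AcSelmer.XAc.charIdeal (W.baseChange K) p κ vbar ∅ γ = Ideal.span {G})
    (hG0 : PowerSeries.constantCoeff G ≠ 0) :
    ((PowerSeries.constantCoeff G).valuation : ℤ) =
      2 * ((padicValInt p (1 - W.frobeniusTrace p + p) : ℤ) - 1 + padicLogOrd W p ι P) -
        2 * (padicValInt p Dt.c : ℤ) := by
  obtain ⟨u', hu'⟩ := generator_constantCoeff_eq_of_thm124b h hp hord hsurj K hK hHN hHp hodd h3
    ι v vbar hv hvbar hne κ hκ γ Dt H ιC P hP G hG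
  -- the left-hand side is non-zero, hence so is the right-hand side
  have hrhs : ((u' : ℤ_[p]) : ℚ_[p]) * ((Dt.c : ℚ_[p])⁻¹) ^ 2 *
      (1 - (W.frobeniusTrace p : ℚ_[p]) * (p : ℚ_[p])⁻¹ + (p : ℚ_[p])⁻¹) ^ 2 *
      ((W.baseChange ℚ_[p]).padicLogPoint (formalIndex W p • padicPointOf W p ι P) /
        (formalIndex W p : ℚ_[p])) ^ 2 ≠ 0 := by
    rw [← hu']
    exact PadicInt.coe_ne_zero.2 hG0
  have hval := congrArg Padic.valuation hu'
  rw [PadicInt.valuation_coe, valuation_unit_mul_bdpShape' u' Dt.c (W.frobeniusTrace p) _ _ hrhs] at hval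
  rw [hval, padicLogOrd]

/-- **Thm. 1.2.4 (b) ∘ Thm. 5.1.3 at the trivial character in the packaged currency**
`AcSelmer.XAc.HasCharValuationAt … n` ("`X_Gr` is `Λ`-torsion with a generator `𝓕`, `𝓕(0) ≠ 0`,
`ord_p 𝓕(0) = n`") `∧ n = 2·(ord_p(1 − a_p + p) − 1 + ord_p log_{ω_E} P_K) − 2·ord_p c_E` — granted
the fact and ONE generator with non-zero constant term (at the cell's data this comes from a
control theorem: CGLS Thm. 5.1.1 / JSW Thm. 3.3.1). Up to the Manin term `2·ord_p c_E` (absent for a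
parametrisation with `p ∤ c_E`) and the log-prime convention (CGLS's/BCS's: log at the prime `v`
induced by `ι`, module strict at `v̄`) this is LITERALLY the body of the cell's Summits predicate
`X11b.IMCWaldspurgerOnTreeGoodAt p κ vbar γ ι P` ((IMC∘BDP)ᵍ at `𝟙`), now fed, at a good ordinary
`p > 3` with (sur), by a published fact. [cite: BurungaleCastellaSkinner2025, Thm. 1.2.4 (b) (p. 3), proof of Cor. 1.3.1 (p. 4)]
[cite: CastellaGrossiLeeSkinner2022, Thm. 5.1.3] [cite: Castella2018, §5 (eq:IMC+BDP) (arXiv:1704.06608 p. 12) (the same shape at `p ∣ N`)] -/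
theorem hasCharValuationAt_of_thm124b (h : thm124b_thm513_generator_constantCoeff)
    (hp : 3 < p) (hord : GoodOrd W p) (hsurj : Surj W p)
    (K : Type) [Field K] [NumberField K] (hK : IsImaginaryQuadratic K)
    (hHN : SatisfiesHeegnerHypothesis (W.conductorNorm ℤ) K) (hHp : SatisfiesHeegnerHypothesis p K)
    (hodd : Odd (NumberField.discr K)) (h3 : NumberField.discr K ≠ -3)
    (ι : K →+* ℚ_[p]) (v vbar : HeightOneSpectrum (𝓞 K))
    (hv : ∀ x : 𝓞 K, x ∈ v.asIdeal ↔ ‖ι (x : K)‖ < 1)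
    (hvbar : ((p : ℕ) : 𝓞 K) ∈ vbar.asIdeal) (hne : vbar ≠ v)
    (κ : ZpExtension K p) (hκ : κ.IsAnticyclotomic)
    (γ : absoluteGaloisGroup K) [Fact (κ.IsTopGenerator γ)]
    {N : ℕ} [NeZero N] (Dt : ModularParametrizationData W N)
    (H : HeegnerDatum N (NumberField.discr K)) (ιC : K →+* ℂ) (P : (W.baseChange K).toAffine.Point)
    (hP : WeierstrassCurve.Affine.Point.map ιC.toRatAlgHom P = heegnerPointComplex Dt H)
    (G : IwasawaAlgebra p) (hG : AcSelmer.XAc.charIdeal (W.baseChange K) p κ vbar ∅ γ = Ideal.span {G})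
    (hG0 : PowerSeries.constantCoeff G ≠ 0) :
    ∃ n : ℕ, AcSelmer.XAc.HasCharValuationAt (W.baseChange K) p κ vbar ∅ γ n ∧
      (n : ℤ) = 2 * ((padicValInt p (1 - W.frobeniusTrace p + p) : ℤ) - 1 + padicLogOrd W p ι P) -
        2 * (padicValInt p Dt.c : ℤ) := by
  obtain ⟨htors, -⟩ :=
    h W p hp hord hsurj K hK hHN hHp hodd h3 ι v vbar hv hvbar hne κ hκ γ N Dt H ιC P hP
  exact ⟨(PowerSeries.constantCoeff G).valuation,
    AcSelmer.XAc.hasCharValuationAt_of_eq htors hG hG0 rfl,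
    valuation_generator_constantCoeff_of_thm124b h hp hord hsurj K hK hHN hHp hodd h3 ι v vbar hv
      hvbar hne κ hκ γ Dt H ιC P hP G hG hG0⟩

end Literature.NumberTheory.EllipticCurves.BurungaleCastellaSkinner2025

end
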